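import Summits.CriticalPhenomena.PercolationContinuityZ3.Theorems.Transplant.ReflexSlabArms
import HarnessLib

/-!
# REFLEX sector-slabs, narrow family `ℝℕ_γ = {x ∈ S_k | x₁ ≥ 0 ∨ x₂ ≤ γ·x₁}` (`γ ≥ 0`): the station design, II — the bottom face (pocket chain), assembly

builds on p205010 (kernel theorem, internal audit signed; external expert review pending) — NOT used in this file.
Lane `prim-bschramm`, seat `prim-bschramm-p2` (gen 23; class C1b, METHOD = input substitution; memo `HOME/bschramm/P2-LATTICES.md` §81);
helper file (`--supports stmt-CriticalPhenomena-4575 --as helper`).  Every bottom-face vertex `u = (u₀, −N, u₂)` of `ℝℕ_γ` with exit `b = u − e₁ ∈ ℝℕ_γ`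
is a pocket vertex: `u₂ ≤ −γ(N+1)` (so `γ < 1` and `u₂ ≤ 0`).  LEFTWARD chain exactly as in `ReflexSlabChains`: two-sided swapped thin arm from `b`
descending leftward to `{x₂ = −(4N+6)}` (in the pocket: `x₂ ≤ b₂ − (b₁ − x₁) ≤ γb₁ − γ(b₁ − x₁) = γx₁` as `γ ≤ 1`), connector
`c₁ = (u₀, −(2N+3), −(2N+3))` with a thin arm leaning `−e₂` up to `T = 5N+7` (column `x₂ ≤ −(2N+3) ≤ x₁`, in `ℝℕ_γ` as `γ ≤ 1`), the sweep from
`Ω = (0, N+1, −(4N+6))`; links `ReflexSlab.link_regions_left` and `RationalHalfSlab.move_apex_cyl_region`.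
**`rfn_design_bottom`** (`P ≥ α₄·α·αₛ`, `≤ 2k+2` edges, window `k + 5N + 7`); helpers `mem_rfn_of_le`, `mem_rfn_of_pocketArm`.  Independent of
`ReflexNarrowDesign` (faces); both are assembled in `ReflexNarrowRow`.
[cite: AizenmanChayesChayesFrohlichRusso1983, §4 Thm 4.4, Cor. to Lemma 4.3, Lemma 4.2 (a)] [cite: GrimmettPercolation1999, §7.2 p. 148] -/

noncomputable section

namespace Summit.CriticalPhenomena.PercolationContinuityZ3.Theorems.Transplant

namespace ReflexNarrow

open MeasureTheory Literature.Probability.Percolation Literature.Probability.LatticeModels SimpleGraph HSU OrthantUniq HalfSlabUniq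
  ConeSlabUniq ThinConeSlab RationalHalfSlab ThreeQuarterSlab ReflexSlab Filter
open scoped Classical Topology

variable {k : ℕ} {N : ℕ} {γ : ℝ}

/-- **Below the diagonal, `x₂ ≤ x₁` ⇒ `x ∈ ℝℕ_γ`** when `γ ≤ 1` (`x₁ ≥ 0` directly, else `x₂ ≤ x₁ ≤ γx₁`). [folklore] -/
theorem mem_rfn_of_le (hγ1 : γ ≤ 1) {x : Site 3} (hx0 : x ∈ slab 3 k) (h12 : x 2 ≤ x 1) : x ∈ {x : Site 3 | x ∈ slab 3 k ∧ (0 ≤ x 1 ∨ (x 2 : ℝ) ≤ γ * (x 1 : ℝ))} := by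
  by_cases hx1 : 0 ≤ x 1
  · exact ⟨hx0, Or.inl hx1⟩
  · have hx1r : (x 1 : ℝ) ≤ 0 := by exact_mod_cast (le_of_lt (not_le.1 hx1))
    have h12r : (x 2 : ℝ) ≤ (x 1 : ℝ) := by exact_mod_cast h12
    have e1 : 1 * (x 1 : ℝ) ≤ γ * (x 1 : ℝ) := mul_le_mul_of_nonpos_right hγ1 hx1r
    exact ⟨hx0, Or.inr (by linarith)⟩

/-- **The leftward descending arm from an apex `b` with `b₂ ≤ γb₁` stays in `ℝℕ_γ`** (`γ ≤ 1`): `x₁ ≤ b₁`, `b₁ − x₁ ≤ b₂ − x₂`. [folklore] -/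
theorem mem_rfn_of_pocketArm (hγ1 : γ ≤ 1) {b x : Site 3} (hb : (b 2 : ℝ) ≤ γ * (b 1 : ℝ)) (hx0 : x ∈ slab 3 k) (h1 : x 1 ≤ b 1)
    (h12 : b 1 - x 1 ≤ b 2 - x 2) : x ∈ {x : Site 3 | x ∈ slab 3 k ∧ (0 ≤ x 1 ∨ (x 2 : ℝ) ≤ γ * (x 1 : ℝ))} := by
  have h1r : (x 1 : ℝ) ≤ (b 1 : ℝ) := by exact_mod_cast h1
  have h12r : (b 1 : ℝ) - (x 1 : ℝ) ≤ (b 2 : ℝ) - (x 2 : ℝ) := by exact_mod_cast h12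
  have hd : 0 ≤ (b 1 : ℝ) - (x 1 : ℝ) := by linarith
  have e1 : γ * ((b 1 : ℝ) - (x 1 : ℝ)) ≤ 1 * ((b 1 : ℝ) - (x 1 : ℝ)) := mul_le_mul_of_nonneg_right hγ1 hd
  refine ⟨hx0, Or.inr ?_⟩
  have : γ * (x 1 : ℝ) = γ * (b 1 : ℝ) - γ * ((b 1 : ℝ) - (x 1 : ℝ)) := by ring
  linarith

/-- **The design at a BOTTOM-face vertex of `ℝℕ_γ`** (`u₁ = −N`, exit `u − e₁ ∈ ℝℕ_γ`, hence a pocket vertex; `γ ≥ 0`, `N ≥ k+1`): the leftward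
pocket chain; `P_{p'} ≥ α₄·α·αₛ`, `≤ 2k + 2` extra edges, window `k + 5N + 7`, station `Ω = (0, N+1, −(4N+6))`.
[cite: AizenmanChayesChayesFrohlichRusso1983, §4 Cor. to Lemma 4.3, Lemma 4.2 (a)] -/
theorem rfn_design_bottom (hγ : 0 ≤ γ) (hN : k + 1 ≤ N) {p' : unitInterval} (A : SlabArmKit k p') {α₄ αₛ : ℝ} (hα₄ : 0 < α₄)
    (harm₄ : ∀ σ : ℤ, (σ = 1 ∨ σ = -1) → ∀ b : Site 3, b ∈ slab 3 k →
      α₄ ≤ (bondPercolation (zdGraph 3) p').real (percolatesVia (withinGraph (zdGraph 3) (steepSet4 k σ b)) b))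
    (harmₛ : ∀ τ : ℤˣ, ∀ σ : ℤ, (σ = 1 ∨ σ = -1) → ∀ b : Site 3, b ∈ slab 3 k →
      αₛ ≤ (bondPercolation (zdGraph 3) p').real
        (percolatesVia (withinGraph (zdGraph 3)
          {x : Site 3 | x ∈ slab 3 k ∧ (0 ≤ σ * (x 1 - b 1) ∧ 4 * (σ * (x 1 - b 1)) ≤ (τ : ℤ) * (x 2 - b 2))}) b))
    {u : Site 3} (hu : u ∈ boxSet 3 N) (huP : u ∈ {x : Site 3 | x ∈ slab 3 k ∧ (0 ≤ x 1 ∨ (x 2 : ℝ) ≤ γ * (x 1 : ℝ))})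
    (hbot : u 1 = -(N : ℤ)) (hbD : u - Pi.single 1 1 ∈ {x : Site 3 | x ∈ slab 3 k ∧ (0 ≤ x 1 ∨ (x 2 : ℝ) ≤ γ * (x 1 : ℝ))}) :
    ∃ E : Set (BondConfig (Site 3)), IsUpperSet E ∧ MeasurableSet E ∧ DeterminedBy E ↑(edgesIn (zdGraph 3) (box 3 (k + 5 * N + 7))) ∧
      α₄ * A.α * αₛ ≤ (bondPercolation (zdGraph 3) p').real E ∧
      ∀ ω ∈ E, ∃ F : Finset (Sym2 (Site 3)), F ⊆ edgesIn (zdGraph 3) (box 3 (k + 5 * N + 7)) ∧ F.card ≤ 2 * k + 2 ∧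
        ω ∪ ↑F ∈ openConnVia (starGraph (withinGraph (zdGraph 3) {x : Site 3 | x ∈ slab 3 k ∧ (0 ≤ x 1 ∨ (x 2 : ℝ) ≤ γ * (x 1 : ℝ))})
          Set.univ (boxSet 3 N)) u ![0, (N : ℤ) + 1, -(4 * (N : ℤ) + 6)] := by
  have hu0 : 0 ≤ u 0 ∧ u 0 ≤ (k : ℤ) := huP.1
  have hub := mem_boxSet_iff.1 hu
  have hu2 := hub 2
  set Ω : Site 3 := ![0, (N : ℤ) + 1, -(4 * (N : ℤ) + 6)] with hΩ_def
  have hΩ0 : Ω 0 = 0 := by simp [hΩ_def]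
  have hΩ1 : Ω 1 = (N : ℤ) + 1 := by simp [hΩ_def]
  have hΩ2 : Ω 2 = -(4 * (N : ℤ) + 6) := by simp [hΩ_def]
  have hΩslab : Ω ∈ slab 3 k := by show 0 ≤ Ω 0 ∧ Ω 0 ≤ (k : ℤ); rw [hΩ0]; exact ⟨le_rfl, by positivity⟩
  have hcyl : ∀ x ∈ {x : Site 3 | x ∈ slab 3 k ∧ (0 ≤ x 1 ∨ (x 2 : ℝ) ≤ γ * (x 1 : ℝ))}, ∀ y ∈ slab 3 k, y 1 = x 1 → y 2 = x 2 →
      y ∈ {x : Site 3 | x ∈ slab 3 k ∧ (0 ≤ x 1 ∨ (x 2 : ℝ) ≤ γ * (x 1 : ℝ))} :=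
    fun x hx y hy h1 h2 => ⟨hy, by rw [h1, h2]; exact hx.2⟩
  have hH : ∀ x ∈ shallowReg k Ω (3 * (N : ℤ) + 5), x ∈ {x : Site 3 | x ∈ slab 3 k ∧ (0 ≤ x 1 ∨ (x 2 : ℝ) ≤ γ * (x 1 : ℝ))} ∧
      x ∉ boxSet 3 N ∧ x 1 ≤ 5 * (N : ℤ) + 7 := by
    intro x hx
    obtain ⟨h0, h1, h2, h3, hZ⟩ := shallowReg_props hx
    rw [hΩ1] at h1 h2; rw [hΩ2] at h2 h3
    exact ⟨⟨h0, Or.inl (by omega)⟩, not_mem_boxSet_of_lt (j := 1) (by rw [abs_of_nonneg (by omega)]; omega), by omega⟩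
  have hwinH : ∀ x ∈ shallowReg k Ω (3 * (N : ℤ) + 5), ∀ j, |x j| ≤ (k + 5 * N + 7 : ℕ) := by
    intro x hx j
    obtain ⟨h0, h1, h2, h3, hZ⟩ := shallowReg_props hx
    rw [hΩ1] at h1 h2; rw [hΩ2] at h2 h3
    fin_cases j <;> rw [abs_le] <;> push_cast <;> constructor <;> omega
  have hq0 : 0 ≤ α₄ * A.α := (mul_pos hα₄ A.α_pos).le
  have hprobH : A.α ≤ (bondPercolation (zdGraph 3) p').real
      (reachEvent (withinGraph (zdGraph 3) (shallowReg k Ω (3 * (N : ℤ) + 5))) Ω {x | x 2 = 3 * (N : ℤ) + 5}) :=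
    le_real_of_subset (percolatesVia_subset_reachEvent_le (self_mem_shallowSet hΩslab) 2 (by rw [hΩ2]; omega)
      (by simpa only [HalfSlabUniq.shallowReg] using shallowReg_finite (k := k) Ω (3 * (N : ℤ) + 5))) (A.shallow_arm Ω hΩslab)
  have hwu : ∀ j, |u j| ≤ (k + 5 * N + 7 : ℕ) := abs_le_of_mem_boxSet hu (by omega)
  -- the exit `b = u − e₁`, a pocket vertex: `b₂ ≤ γ b₁ = −γ(N+1)`, whence `γ ≤ 1` and `b₂ ≤ 0`
  set b : Site 3 := u - Pi.single 1 1 with hb_def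
  have hb0 : b 0 = u 0 := by simp [hb_def]
  have hb1 : b 1 = u 1 - 1 := by simp [hb_def]
  have hb2 : b 2 = u 2 := by simp [hb_def]
  have hbslab : b ∈ slab 3 k := by show 0 ≤ b 0 ∧ b 0 ≤ (k : ℤ); rw [hb0]; exact hu0
  have hbbox : b ∉ boxSet 3 N := not_mem_boxSet_of_lt (j := 1) (by rw [hb1, hbot, abs_of_nonpos (by omega)]; omega)
  have hadj : (zdGraph 3).Adj u b := (zdGraph_adj_iff _ _).2 ⟨1, Or.inr (by rw [hb_def, sub_add_cancel])⟩
  have hwb : ∀ j, |b j| ≤ (k + 5 * N + 7 : ℕ) := abs_le_of_mem_boxSet (sub_single_mem_boxSet hu 1) (by omega)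
  set T : ℤ := 5 * (N : ℤ) + 7 with hT
  have hbc : (b 2 : ℝ) ≤ γ * (b 1 : ℝ) := by
    rcases hbD.2 with h | h
    · exfalso; rw [hb1, hbot] at h; omega
    · exact h
  have hb2N : (-(N : ℝ)) ≤ (b 2 : ℝ) := by exact_mod_cast (show -(N : ℤ) ≤ b 2 by rw [hb2]; exact hu2.1)
  have hb1r : ((b 1 : ℤ) : ℝ) = -(N : ℝ) - 1 := by rw [hb1, hbot]; push_cast; ring
  have hN0 : (0 : ℝ) ≤ (N : ℝ) := by positivity
  have hγ1 : γ ≤ 1 := by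
    by_contra h
    push Not at h
    rw [hb1r] at hbc
    nlinarith
  have hb2le : b 2 ≤ 0 := by
    have : (b 2 : ℝ) ≤ 0 := by rw [hb1r] at hbc; nlinarith
    exact_mod_cast this
  have hbP : b ∈ {x : Site 3 | x ∈ slab 3 k ∧ (0 ≤ x 1 ∨ (x 2 : ℝ) ≤ γ * (x 1 : ℝ))} := hbD
  set c₁ : Site 3 := ![u 0, -(2 * (N : ℤ) + 3), -(2 * (N : ℤ) + 3)] with hc_def
  have hc0 : c₁ 0 = u 0 := by simp [hc_def]
  have hc1' : c₁ 1 = -(2 * (N : ℤ) + 3) := by simp [hc_def]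
  have hc2 : c₁ 2 = -(2 * (N : ℤ) + 3) := by simp [hc_def]
  set L : ℤ := -(4 * (N : ℤ) + 6) with hL
  have hcslab : c₁ ∈ slab 3 k := by show 0 ≤ c₁ 0 ∧ c₁ 0 ≤ (k : ℤ); rw [hc0]; exact hu0
  set H₁ : Set (Site 3) := {x : Site 3 | x ∈ slab 3 k ∧
    (0 ≤ (-1 : ℤ) * (x 1 - b 1) ∧ 4 * ((-1 : ℤ) * (x 1 - b 1)) ≤ ((-1 : ℤˣ) : ℤ) * (x 2 - b 2))} ∩ {x | L ≤ x 2} with hH₁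
  set S₂ : Set (Site 3) := steepSet4 k (-1) c₁ ∩ {x | x 1 ≤ T} with hS₂
  have hbH₁ : b ∈ H₁ := ⟨⟨hbslab, by simp, by simp⟩, by show L ≤ b 2; rw [hb2]; omega⟩
  have hcS₂ : c₁ ∈ S₂ := ⟨self_mem_steepSet4 hcslab, by show c₁ 1 ≤ T; rw [hc1']; omega⟩
  have hH₁props : ∀ x ∈ H₁, (0 ≤ x 0 ∧ x 0 ≤ (k : ℤ)) ∧ (c₁ 1 ≤ x 1 ∧ x 1 ≤ b 1) ∧ (L ≤ x 2 ∧ x 2 ≤ b 2) ∧ b 1 - x 1 ≤ b 2 - x 2 := by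
    rintro x ⟨⟨h0, h1, h2⟩, hxL⟩
    have hxL' : L ≤ x 2 := hxL
    rw [Units.val_neg, Units.val_one] at h2
    rw [neg_one_mul] at h1 h2
    rw [hc1']; rw [hb1, hbot] at h1 h2 ⊢; rw [hb2] at h2 ⊢
    exact ⟨h0, ⟨by omega, by omega⟩, ⟨hxL', by omega⟩, by omega⟩
  have hS₂props : ∀ x ∈ S₂, (0 ≤ x 0 ∧ x 0 ≤ (k : ℤ)) ∧ (c₁ 1 ≤ x 1 ∧ x 1 ≤ T) ∧ (L ≤ x 2 ∧ x 2 ≤ -(2 * (N : ℤ) + 3)) := by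
    rintro x ⟨⟨h0, h1, h2⟩, hxT⟩
    have hxT' : x 1 ≤ T := hxT
    rw [hc2, neg_one_mul] at h1 h2; rw [hc1'] at h2 ⊢
    exact ⟨h0, ⟨by omega, hxT'⟩, ⟨by omega, by omega⟩⟩
  have hH₁D : ∀ x ∈ H₁, x ∈ {x : Site 3 | x ∈ slab 3 k ∧ (0 ≤ x 1 ∨ (x 2 : ℝ) ≤ γ * (x 1 : ℝ))} ∧ x ∉ boxSet 3 N := fun x hx => by
    obtain ⟨h0, ⟨-, h1⟩, -, h12⟩ := hH₁props x hx
    refine ⟨mem_rfn_of_pocketArm hγ1 hbc h0 h1 h12, not_mem_boxSet_of_lt (j := 1) ?_⟩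
    rw [hb1, hbot] at h1; rw [abs_of_nonpos (by omega)]; omega
  have hS₂D : ∀ x ∈ S₂, x ∈ {x : Site 3 | x ∈ slab 3 k ∧ (0 ≤ x 1 ∨ (x 2 : ℝ) ≤ γ * (x 1 : ℝ))} ∧ x ∉ boxSet 3 N := fun x hx => by
    obtain ⟨h0, ⟨h1, -⟩, ⟨-, h2⟩⟩ := hS₂props x hx
    rw [hc1'] at h1
    exact ⟨mem_rfn_of_le hγ1 h0 (by omega), not_mem_boxSet_of_lt (j := 2) (by rw [abs_of_nonpos (by omega)]; omega)⟩
  have hM₁ : ∀ x ∈ S₂ ∪ H₁, ∀ j, |x j| ≤ (k + 5 * N + 7 : ℕ) := by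
    rintro x (hx | hx) j
    · obtain ⟨h0, ⟨h1, h2⟩, ⟨h3, h4⟩⟩ := hS₂props x hx
      rw [hc1'] at h1
      fin_cases j <;> rw [abs_le] <;> push_cast <;> constructor <;> omega
    · obtain ⟨h0, ⟨h1, h2⟩, ⟨h3, h4⟩, -⟩ := hH₁props x hx
      rw [hc1'] at h1; rw [hb1, hbot] at h2; rw [hb2] at h4
      fin_cases j <;> rw [abs_le] <;> push_cast <;> constructor <;> omega
  have hM₂ : ∀ x ∈ S₂ ∪ shallowReg k Ω (3 * (N : ℤ) + 5), ∀ j, |x j| ≤ (k + 5 * N + 7 : ℕ) := by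
    rintro x (hx | hx) j
    · exact hM₁ x (Or.inl hx) j
    · exact hwinH x hx j
  set E₂ : Set (BondConfig (Site 3)) := reachEvent (withinGraph (zdGraph 3) S₂) c₁ {x | x 1 = T} ∩
    reachEvent (withinGraph (zdGraph 3) (shallowReg k Ω (3 * (N : ℤ) + 5))) Ω {x | x 2 = 3 * (N : ℤ) + 5} with hE₂
  set E₁ : Set (BondConfig (Site 3)) := reachEvent (withinGraph (zdGraph 3) H₁) b {x | x 2 = L} with hE₁
  have hS₂fin : S₂.Finite := (boxSet_finite _).subset (subset_boxSet_of_abs_le fun x hx => hM₁ x (Or.inl hx))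
  have hH₁fin : H₁.Finite := (boxSet_finite _).subset (subset_boxSet_of_abs_le fun x hx => hM₁ x (Or.inr hx))
  have hprobS₂ : α₄ ≤ (bondPercolation (zdGraph 3) p').real (reachEvent (withinGraph (zdGraph 3) S₂) c₁ {x | x 1 = T}) :=
    le_real_of_subset (percolatesVia_subset_reachEvent_le (self_mem_steepSet4 hcslab) 1 (by rw [hc1']; omega)
      (by simpa [hS₂] using hS₂fin)) (harm₄ (-1) (Or.inr rfl) c₁ hcslab)
  have hprobH₁ : αₛ ≤ (bondPercolation (zdGraph 3) p').real E₁ :=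
    le_real_of_subset (percolatesVia_subset_reachEvent_ge (S := {x : Site 3 | x ∈ slab 3 k ∧
        (0 ≤ (-1 : ℤ) * (x 1 - b 1) ∧ 4 * ((-1 : ℤ) * (x 1 - b 1)) ≤ ((-1 : ℤˣ) : ℤ) * (x 2 - b 2))}) ⟨hbslab, by simp, by simp⟩ 2
        (by rw [hb2]; omega) (by simpa [hH₁] using hH₁fin)) (harmₛ (-1) (-1) (Or.inr rfl) b hbslab)
  have hE₂upper : IsUpperSet E₂ := (isUpperSet_reachEvent _ _ _).inter (isUpperSet_reachEvent _ _ _)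
  have hE₂meas : MeasurableSet E₂ := (measurableSet_reachEvent _ _ _).inter (measurableSet_reachEvent _ _ _)
  have hprobE₂ : α₄ * A.α ≤ (bondPercolation (zdGraph 3) p').real E₂ :=
    harris2_of_le p' (isUpperSet_reachEvent _ _ _) (isUpperSet_reachEvent _ _ _) (measurableSet_reachEvent _ _ _)
      (measurableSet_reachEvent _ _ _) hα₄.le hprobS₂ hprobH
  refine ⟨E₂ ∩ E₁, hE₂upper.inter (isUpperSet_reachEvent _ _ _), hE₂meas.inter (measurableSet_reachEvent _ _ _), ?_, ?_,
    fun ω hω => ?_⟩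
  · exact (((determinedBy_reachEvent _ _ _).mono (edgeSet_withinGraph_subset_edgesIn (subset_boxSet_of_abs_le fun x hx =>
      hM₁ x (Or.inl hx)))).inter ((determinedBy_reachEvent _ _ _).mono (edgeSet_withinGraph_subset_edgesIn
        (subset_boxSet_of_abs_le fun x hx => hwinH x hx)))).inter
      ((determinedBy_reachEvent _ _ _).mono (edgeSet_withinGraph_subset_edgesIn (subset_boxSet_of_abs_le fun x hx => hM₁ x (Or.inr hx))))
  · exact harris2_of_le p' hE₂upper (isUpperSet_reachEvent _ _ _) hE₂meas (measurableSet_reachEvent _ _ _) hq0 hprobE₂ hprobH₁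
  · obtain ⟨hω₂, hω₁⟩ := hω
    obtain ⟨F₂, hF₂s, hF₂c, hF₂r⟩ := move_apex_cyl_region (D := {x : Site 3 | x ∈ slab 3 k ∧ (0 ≤ x 1 ∨ (x 2 : ℝ) ≤ γ * (x 1 : ℝ))})
      (by omega) hcyl (S := S₂) (fun x hx => (hS₂props x hx).1) hcS₂ hΩslab (by rw [hΩ2]; omega) (by rw [hc1', hΩ1]; omega)
      (fun x hx => ⟨(hS₂D x hx).1, (hS₂D x hx).2, (hS₂props x hx).2.1, by
        obtain ⟨-, -, h3, h4⟩ := hS₂props x hx; rw [hΩ2]; exact ⟨by omega, by omega⟩⟩) hH hM₂ hω₂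
    have hKJ : ∀ s ∈ S₂, ∀ t ∈ H₁, s 1 = t 1 → s 2 = t 2 →
        withinGraph (zdGraph 3) {z | ∀ j, min (s j) (t j) ≤ z j ∧ z j ≤ max (s j) (t j)} ≤
          starGraph (withinGraph (zdGraph 3) {x : Site 3 | x ∈ slab 3 k ∧ (0 ≤ x 1 ∨ (x 2 : ℝ) ≤ γ * (x 1 : ℝ))})
            Set.univ (boxSet 3 N) := by
      intro s hs t ht h1 h2
      refine withinGraph_le_dext fun z hz => ?_
      obtain ⟨hs0, ⟨hs1, -⟩, ⟨-, hs2⟩⟩ := hS₂props s hs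
      obtain ⟨ht0, -, -⟩ := hH₁props t ht
      rw [hc1'] at hs1
      have hz1 : z 1 = s 1 := eq_of_mem_bbox hz h1
      have hz2 : z 2 = s 2 := eq_of_mem_bbox hz h2
      have hz0 := hz 0
      have hzslab : z ∈ slab 3 k := ⟨le_trans (le_min hs0.1 ht0.1) hz0.1, le_trans hz0.2 (max_le hs0.2 ht0.2)⟩
      refine ⟨mem_rfn_of_le hγ1 hzslab (by rw [hz1, hz2]; omega), not_mem_boxSet_of_lt (j := 2) ?_⟩
      rw [hz2, abs_of_nonpos (by omega)]; omega
    obtain ⟨F₁, hF₁s, hF₁c, hF₁r⟩ := link_regions_left (S := S₂) (H := H₁) (fun x hx => (hS₂props x hx).1)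
      (fun x hx => (hH₁props x hx).1) hcS₂ hbH₁
      (fun x hx => ⟨(hS₂props x hx).2.1.1, (hS₂props x hx).2.1.2, (hS₂props x hx).2.2.1, by
        rw [hb2]; have := (hS₂props x hx).2.2.2; have := hu2.1; omega⟩)
      (fun x hx => ⟨(hH₁props x hx).2.1.1, (hH₁props x hx).2.1.2.trans (by rw [hb1]; omega), (hH₁props x hx).2.2.1.1,
        (hH₁props x hx).2.2.1.2⟩)
      (withinGraph_le_dext hS₂D) (withinGraph_le_dext hH₁D) hKJ hM₁ ⟨hω₂.1, hω₁⟩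
    have hbc' : ω ∪ ↑F₁ ∈ openConnVia (starGraph (withinGraph (zdGraph 3) {x : Site 3 | x ∈ slab 3 k ∧ (0 ≤ x 1 ∨ (x 2 : ℝ) ≤ γ * (x 1 : ℝ))})
        Set.univ (boxSet 3 N)) b c₁ := mem_openConnVia_iff.2 (mem_openConnVia_iff.1 hF₁r).symm
    have hbΩ := openConnVia_trans hbc' hF₂r
    have hcard : (insert s(u, b) (F₁ ∪ F₂)).card ≤ 2 * k + 2 :=
      (Finset.card_insert_le _ _).trans (by have := Finset.card_union_le F₁ F₂; omega)
    refine ⟨insert s(u, b) (F₁ ∪ F₂), ?_, hcard, ?_⟩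
    · intro e he
      rcases Finset.mem_insert.1 he with rfl | he
      · exact mem_edgesIn_of_adj hadj hwu hwb
      · rcases Finset.mem_union.1 he with he | he
        · exact hF₁s he
        · exact hF₂s he
    · exact openConnVia_step (dext_adj_of hadj huP hbP fun h' => hbbox h'.2) (Finset.mem_insert_self _ _)
        (openConnVia_mono_finset (Finset.subset_insert _ _) hbΩ)


end ReflexNarrow

end Summit.CriticalPhenomena.PercolationContinuityZ3.Theorems.Transplant

end
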